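import Summits.AtomisticToContinuum.BoseEinsteinCondensation.Theorems.BECThomsonPrincipleDefs
import Literature.MathematicalPhysics.QuantumManyBody.PeriodicBoseGasFourier
import Literature.MathematicalPhysics.QuantumManyBody.PeriodicBoseGasFracEnergy
import Literature.MathematicalPhysics.QuantumManyBody.CoarseModeRayPOVMFormCore
import Literature.MathematicalPhysics.QuantumManyBody.OneBodyCurrentGain
import Literature.MathematicalPhysics.QuantumManyBody.LangevinGenerator
import Literature.MathematicalPhysics.QuantumManyBody.PeriodicConfigFourier
import HarnessLib

/-!
# Route `BECThomsonPrinciple`, crux `FibreConductance` (stmt-AtomisticToContinuum-9480),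
# line `parseval-shell-bootstrap` — fibre infrastructure I: regularity of `W`, `ψ`, `β`

Regularity, periodicity and positivity of the fibre objects of the line's `Defs` file
(`BECThomsonPrincipleDefs`: the bath weight `fibreW Φ X = ∫_cell ‖Φ(X[0↦y])‖² dy`, the
conditional amplitude `fibrePsi Φ = ‖Φ‖/√W` and its Fourier mode
`fibreBeta n Φ X = ∫_cell e^{ik·y} ψ(X[0↦y]) dy`, `k = 2πn/L`) for a `C¹`, fully periodic,
zero-free trial state `Φ` on the torus `(ℝ³/Lℤ³)^{m+1}` — the FIBRE INTERFACE consumed by the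
stubs `stub_transport`, `stub_betaCorrector`, `stub_parsevalShell` of the checked skeleton
`Cruxes/FibreConductance/Lines/parseval-shell-bootstrap.lean`:

* `W`, `β` are constant along the `x₀`-fibre (`fibreW_update`, `fibreBeta_update`), `Lℤ³`-periodic
  in every particle (`fibreW_periodic`, `fibrePsi_periodic`, `fibreBeta_periodic`) and `C¹`
  (`contDiff_fibreW`, `contDiff_fibrePsi`, `contDiff_fibreBeta`: one derivative under the integral
  over the bounded cell, `contDiff_one_parametric_setIntegral_of_isBounded`);
* `W > 0`, `ψ > 0` for a zero-free state, `|Φ|² = Wψ²`, `∫_cell ψ² dy = 1`, and uniform two-sided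
  bounds `0 < c ≤ ψ, W ≤ C` (continuity + periodicity + compactness of `[0,L]^{3N}`);
* `β = L³ ĉ_{-n}(ψ(·|X̂))` (`cellFourierCoeff` normalisation) and Bessel's bound `|β|² ≤ L³`;
* periodic integration by parts in the fibre variable, `∫_{cell^N} ∂_{x_{0,l}} F dX = 0`
  (Fubini at particle `0` + `integral_cell_fderiv_eq_zero`).

Registered anchor (`--supports` the crux item): `contDiff_fibrePsi`.

References: the line card `Cruxes/FibreConductance/Lines/parseval-shell-bootstrap.md`; LSSY2005
§1.2 (1.17) (occupations / Fourier modes on the cell).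
-/

noncomputable section

namespace Summit.AtomisticToContinuum.BoseEinsteinCondensation.Cruxes.FibreConductance.ParsevalShellBootstrap

open MeasureTheory
open scoped ENNReal
open Literature.MathematicalPhysics.QuantumManyBody.BoseGas

variable {m : ℕ} {L : ℝ}

/-! ### Slice bookkeeping: `update X 0 y` -/

/-- The fibre through `X` in the library's slice coordinates: `X[0 ↦ y] = vecCons y (tail X)`. [folklore] -/
theorem update_eq_vecCons (X : Config (m + 1)) (y : Space) :
    Function.update X 0 y = Matrix.vecCons y (Fin.tail X) := by
  conv_lhs => rw [← Fin.cons_self_tail X]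
  exact Fin.update_cons_zero (X 0) (Fin.tail X) y

/-- Updating particle `0` forgets a previous translation of particle `0`. [folklore] -/
theorem update_add_single_zero (X : Config (m + 1)) (v y : Space) :
    Function.update (X + Pi.single 0 v) 0 y = Function.update X 0 y := by
  funext j
  rcases eq_or_ne j 0 with rfl | hj
  · simp
  · simp [hj]

/-- Updating particle `0` commutes with translating another particle. [folklore] -/
theorem update_add_single_of_ne {i : Fin (m + 1)} (hi : i ≠ 0) (X : Config (m + 1))
    (v y : Space) :
    Function.update (X + Pi.single i v) 0 y = Function.update X 0 y + Pi.single i v := by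
  funext j
  rcases eq_or_ne j 0 with rfl | hj
  · simp [hi.symm]
  · simp [hj]

/-- Translating the fibre variable: `X[0 ↦ y + v] = X[0 ↦ y] + e₀ ⊗ v`. [folklore] -/
theorem update_zero_add (X : Config (m + 1)) (y v : Space) :
    Function.update X 0 (y + v) = Function.update X 0 y + Pi.single 0 v := by
  funext j
  rcases eq_or_ne j 0 with rfl | hj
  · simp
  · simp [hj]

/-- The substitution `(y, X) ↦ X[0 ↦ y]` is smooth (linear). [folklore] -/
theorem contDiff_update_zero {n : WithTop ℕ∞} :
    ContDiff ℝ n fun q : Space × Config (m + 1) => Function.update q.2 0 q.1 := by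
  rw [contDiff_pi]
  intro j
  rcases eq_or_ne j 0 with rfl | hj
  · simp only [Function.update_self]
    exact contDiff_fst
  · simp only [Function.update_of_ne hj]
    exact (contDiff_apply ℝ Space j).comp contDiff_snd

/-- The substitution `(y, X) ↦ X[0 ↦ y]` is continuous. [folklore] -/
theorem continuous_update_zero :
    Continuous fun q : Space × Config (m + 1) => Function.update q.2 0 q.1 :=
  continuous_snd.update 0 continuous_fst

/-! ### The phase factor `e^{ik·x}` -/

/-- The phase factor is the library's plane wave: `phase L n = cellWave L n`. [folklore] -/
theorem phase_eq_cellWave (L : ℝ) (n : Fin 3 → ℤ) (x : Space) : phase L n x = cellWave L n x := by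
  rw [cellWave_apply, phase]
  congr 1
  push_cast
  ring

/-- The phase factor is smooth (all orders, including analytic bookkeeping `k = ω`). [folklore] -/
theorem contDiff_phase (L : ℝ) (n : Fin 3 → ℤ) {k : WithTop ℕ∞} : ContDiff ℝ k (phase L n) := by
  unfold phase
  refine Complex.contDiff_exp.comp (contDiff_const.mul (Complex.ofRealCLM.contDiff.comp ?_))
  exact contDiff_const.mul (ContDiff.sum fun j _ =>
    contDiff_const.mul (PiLp.proj (𝕜 := ℝ) 2 (fun _ : Fin 3 => ℝ) j).contDiff)

/-- `|phase| = 1`. [folklore] -/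
theorem norm_phase (L : ℝ) (n : Fin 3 → ℤ) (x : Space) : ‖phase L n x‖ = 1 := by
  rw [phase_eq_cellWave, norm_cellWave]

/-- The phase factor is `Lℤ³`-periodic (`L ≠ 0`). [folklore] -/
theorem phase_periodic (hL : L ≠ 0) (n : Fin 3 → ℤ) (x : Space) (k : Fin 3) :
    phase L n (x + EuclideanSpace.single k L) = phase L n x := by
  rw [phase_eq_cellWave, phase_eq_cellWave, cellWave_periodic hL]

/-! ### The bath weight `W` -/

/-- `W` is constant along the `x₀`-fibre. [folklore] -/
theorem fibreW_update (Φ : PeriodicTrialState (m + 1) L) (X : Config (m + 1)) (y : Space) :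
    fibreW Φ (Function.update X 0 y) = fibreW Φ X := by
  simp only [fibreW, Function.update_idem]

/-- The slice `y ↦ Φ(X[0 ↦ y])` is continuous. [folklore] -/
theorem continuous_slice (Φ : PeriodicTrialState (m + 1) L) (X : Config (m + 1)) :
    Continuous fun y : Space => Φ.ψ (Function.update X 0 y) :=
  Φ.contDiff.continuous.comp (continuous_const.update 0 continuous_id)

/-- `W > 0` for a zero-free state (`L > 0`). [folklore] -/
theorem fibreW_pos (hL : 0 < L) (Φ : PeriodicTrialState (m + 1) L) (hΦ : ∀ X, Φ.ψ X ≠ 0)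
    (X : Config (m + 1)) : 0 < fibreW Φ X := by
  unfold fibreW
  have hc : Continuous fun y : Space => ‖Φ.ψ (Function.update X 0 y)‖ ^ 2 :=
    ((continuous_slice Φ X).norm).pow 2
  rw [integral_pos_iff_support_of_nonneg_ae (Filter.Eventually.of_forall fun y => sq_nonneg _)
    (integrableOn_cell hc)]
  have hsupp : Function.support (fun y : Space => ‖Φ.ψ (Function.update X 0 y)‖ ^ 2) = Set.univ :=
    Set.eq_univ_of_forall fun y => by simpa [Function.mem_support] using hΦ _
  rw [hsupp, Measure.restrict_apply_univ, volume_cell]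
  exact ENNReal.pow_pos (ENNReal.ofReal_pos.2 hL) 3

/-- `W ≥ 0` always. [folklore] -/
theorem fibreW_nonneg (Φ : PeriodicTrialState (m + 1) L) (X : Config (m + 1)) : 0 ≤ fibreW Φ X :=
  setIntegral_nonneg (measurableSet_cell L) fun _ _ => sq_nonneg _

/-- `W` is `Lℤ³`-periodic in every particle. [folklore] -/
theorem fibreW_periodic (Φ : PeriodicTrialState (m + 1) L) (X : Config (m + 1)) (i : Fin (m + 1))
    (k : Fin 3) : fibreW Φ (X + Pi.single i (EuclideanSpace.single k L)) = fibreW Φ X := by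
  unfold fibreW
  rcases eq_or_ne i 0 with rfl | hi
  · simp only [update_add_single_zero]
  · simp only [update_add_single_of_ne hi, Φ.periodic]

/-- `W` is `C¹` (differentiation under the integral over the bounded cell). [folklore] -/
theorem contDiff_fibreW (Φ : PeriodicTrialState (m + 1) L) : ContDiff ℝ 1 (fibreW Φ) := by
  have hH : ContDiff ℝ 1 fun q : Space × Config (m + 1) => ‖Φ.ψ (Function.update q.2 0 q.1)‖ ^ 2 :=
    (Φ.contDiff.comp contDiff_update_zero).norm_sq ℝ
  exact contDiff_one_parametric_setIntegral_of_isBounded (μ := volume) (isBounded_cell L)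
    (measurableSet_cell L) hH

/-- `W` is continuous. [folklore] -/
theorem continuous_fibreW (Φ : PeriodicTrialState (m + 1) L) : Continuous (fibreW Φ) :=
  (contDiff_fibreW Φ).continuous

/-! ### The conditional amplitude `ψ` -/

/-- `ψ > 0` for a zero-free state. [folklore] -/
theorem fibrePsi_pos (hL : 0 < L) (Φ : PeriodicTrialState (m + 1) L) (hΦ : ∀ X, Φ.ψ X ≠ 0)
    (X : Config (m + 1)) : 0 < fibrePsi Φ X :=
  div_pos (norm_pos_iff.2 (hΦ X)) (Real.sqrt_pos.2 (fibreW_pos hL Φ hΦ X))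

/-- `ψ ≥ 0` always. [folklore] -/
theorem fibrePsi_nonneg (Φ : PeriodicTrialState (m + 1) L) (X : Config (m + 1)) :
    0 ≤ fibrePsi Φ X :=
  div_nonneg (norm_nonneg _) (Real.sqrt_nonneg _)

/-- `ψ` is `Lℤ³`-periodic in every particle. [folklore] -/
theorem fibrePsi_periodic (Φ : PeriodicTrialState (m + 1) L) (X : Config (m + 1)) (i : Fin (m + 1))
    (k : Fin 3) : fibrePsi Φ (X + Pi.single i (EuclideanSpace.single k L)) = fibrePsi Φ X := by
  simp only [fibrePsi, Φ.periodic, fibreW_periodic]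

/-- `ψ` is `C¹` on configuration space (jointly in fibre and bath variables). [folklore] -/
theorem contDiff_fibrePsi (hL : 0 < L) (Φ : PeriodicTrialState (m + 1) L) (hΦ : ∀ X, Φ.ψ X ≠ 0) :
    ContDiff ℝ 1 (fibrePsi Φ) := by
  have h1 : ContDiff ℝ 1 fun X => ‖Φ.ψ X‖ :=
    contDiff_iff_contDiffAt.2 fun X => Φ.contDiff.contDiffAt.norm ℝ (hΦ X)
  have h2 : ContDiff ℝ 1 fun X => Real.sqrt (fibreW Φ X) :=
    (contDiff_fibreW Φ).sqrt fun X => (fibreW_pos hL Φ hΦ X).ne'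
  exact h1.div h2 fun X => (Real.sqrt_pos.2 (fibreW_pos hL Φ hΦ X)).ne'

/-- `ψ` is continuous (zero-free state, `L > 0`). [folklore] -/
theorem continuous_fibrePsi (hL : 0 < L) (Φ : PeriodicTrialState (m + 1) L) (hΦ : ∀ X, Φ.ψ X ≠ 0) :
    Continuous (fibrePsi Φ) :=
  (contDiff_fibrePsi hL Φ hΦ).continuous

/-- `|Φ|² = W ψ²`. [folklore] -/
theorem norm_sq_eq_fibreW_mul_sq (hL : 0 < L) (Φ : PeriodicTrialState (m + 1) L)
    (hΦ : ∀ X, Φ.ψ X ≠ 0) (X : Config (m + 1)) :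
    ‖Φ.ψ X‖ ^ 2 = fibreW Φ X * fibrePsi Φ X ^ 2 := by
  have hW := fibreW_pos hL Φ hΦ X
  rw [fibrePsi, div_pow, Real.sq_sqrt hW.le, mul_div_cancel₀ _ hW.ne']

/-- `|Φ| = √W ψ`. [folklore] -/
theorem norm_eq_sqrt_fibreW_mul (hL : 0 < L) (Φ : PeriodicTrialState (m + 1) L)
    (hΦ : ∀ X, Φ.ψ X ≠ 0) (X : Config (m + 1)) :
    ‖Φ.ψ X‖ = Real.sqrt (fibreW Φ X) * fibrePsi Φ X := by
  have hW := Real.sqrt_pos.2 (fibreW_pos hL Φ hΦ X)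
  rw [fibrePsi, mul_div_cancel₀ _ hW.ne']

/-- The conditional law is normalised on every fibre: `∫_cell ψ(y|X̂)² dy = 1`. [folklore] -/
theorem integral_fibrePsi_sq (hL : 0 < L) (Φ : PeriodicTrialState (m + 1) L) (hΦ : ∀ X, Φ.ψ X ≠ 0)
    (X : Config (m + 1)) : ∫ y in cell L, fibrePsi Φ (Function.update X 0 y) ^ 2 = 1 := by
  have hW := fibreW_pos hL Φ hΦ X
  have h : ∀ y, fibrePsi Φ (Function.update X 0 y) ^ 2 =
      ‖Φ.ψ (Function.update X 0 y)‖ ^ 2 / fibreW Φ X := by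
    intro y
    rw [fibrePsi, fibreW_update, div_pow, Real.sq_sqrt hW.le]
  simp_rw [h]
  rw [integral_div, div_eq_one_iff_eq hW.ne']
  rfl

/-- A continuous function on configuration space that is `Lℤ³`-periodic in every particle attains
its extrema (on the compact closed box `[0,L]^{3N}`, which contains a lattice translate of every
configuration). [folklore] -/
theorem exists_forall_le_and_le_of_periodic (hL : 0 < L) {f : Config (m + 1) → ℝ}
    (hf : Continuous f) (hper : IsTorusPeriodic L f) :
    ∃ X₁ X₂ : Config (m + 1), ∀ X, f X₁ ≤ f X ∧ f X ≤ f X₂ := by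
  obtain ⟨X₁, -, h₁⟩ := (isCompact_closedBoxN (m + 1) L).exists_isMinOn
    ⟨_, fromUnitTorusN_mem_closedBoxN hL 0⟩ hf.continuousOn
  obtain ⟨X₂, -, h₂⟩ := (isCompact_closedBoxN (m + 1) L).exists_isMaxOn
    ⟨_, fromUnitTorusN_mem_closedBoxN hL 0⟩ hf.continuousOn
  refine ⟨X₁, X₂, fun X => ?_⟩
  have hrep : f (fromUnitTorusN L (toUnitTorusN L X)) = f X := by
    obtain ⟨n, hn⟩ := exists_fromUnitTorusN_toUnitTorusN_eq hL X
    rw [hn, hper.add_latticeVecN]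
  have hmem := fromUnitTorusN_mem_closedBoxN hL (toUnitTorusN L X) (N := m + 1)
  exact ⟨hrep ▸ (isMinOn_iff.1 h₁) _ hmem, hrep ▸ (isMaxOn_iff.1 h₂) _ hmem⟩

/-- Two-sided uniform bounds for `ψ` and `W` (continuous, periodic, positive ⇒ bounded away from
`0` and `∞` on all of configuration space). [folklore] -/
theorem exists_fibre_bounds (hL : 0 < L) (Φ : PeriodicTrialState (m + 1) L) (hΦ : ∀ X, Φ.ψ X ≠ 0) :
    ∃ c C : ℝ, 0 < c ∧ (∀ X, c ≤ fibrePsi Φ X) ∧ (∀ X, fibrePsi Φ X ≤ C) ∧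
      (∀ X, c ≤ fibreW Φ X) ∧ (∀ X, fibreW Φ X ≤ C) := by
  obtain ⟨X₁, X₂, hψ⟩ := exists_forall_le_and_le_of_periodic hL (continuous_fibrePsi hL Φ hΦ)
    (fun X i k => fibrePsi_periodic Φ X i k)
  obtain ⟨Y₁, Y₂, hW⟩ := exists_forall_le_and_le_of_periodic hL (continuous_fibreW Φ)
    (fun X i k => fibreW_periodic Φ X i k)
  exact ⟨min (fibrePsi Φ X₁) (fibreW Φ Y₁), max (fibrePsi Φ X₂) (fibreW Φ Y₂),
    lt_min (fibrePsi_pos hL Φ hΦ X₁) (fibreW_pos hL Φ hΦ Y₁),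
    fun X => (min_le_left _ _).trans (hψ X).1, fun X => (hψ X).2.trans (le_max_left _ _),
    fun X => (min_le_right _ _).trans (hW X).1, fun X => (hW X).2.trans (le_max_right _ _)⟩

/-! ### The Fourier mode `β` of the conditional amplitude -/

/-- `β` is constant along the `x₀`-fibre. [folklore] -/
theorem fibreBeta_update (n : Fin 3 → ℤ) (Φ : PeriodicTrialState (m + 1) L) (X : Config (m + 1))
    (y : Space) : fibreBeta n Φ (Function.update X 0 y) = fibreBeta n Φ X := by
  simp only [fibreBeta, Function.update_idem]

/-- `β` is `Lℤ³`-periodic in every particle (`L > 0`: the phase is `L`-periodic). [folklore] -/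
theorem fibreBeta_periodic (hL : 0 < L) (n : Fin 3 → ℤ) (Φ : PeriodicTrialState (m + 1) L)
    (X : Config (m + 1)) (i : Fin (m + 1)) (k : Fin 3) :
    fibreBeta n Φ (X + Pi.single i (EuclideanSpace.single k L)) = fibreBeta n Φ X := by
  have _ := hL -- (the statement holds for every `L`; `hL` is part of the frozen interface)
  unfold fibreBeta
  rcases eq_or_ne i 0 with rfl | hi
  · simp only [update_add_single_zero]
  · simp only [update_add_single_of_ne hi, fibrePsi_periodic]

/-- `β` is `C¹`. [folklore] -/
theorem contDiff_fibreBeta (hL : 0 < L) (n : Fin 3 → ℤ) (Φ : PeriodicTrialState (m + 1) L)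
    (hΦ : ∀ X, Φ.ψ X ≠ 0) : ContDiff ℝ 1 (fibreBeta n Φ) := by
  have hG : ContDiff ℝ 1 fun q : Space × Config (m + 1) =>
      phase L n q.1 * (fibrePsi Φ (Function.update q.2 0 q.1) : ℂ) :=
    ((contDiff_phase L n).comp contDiff_fst).mul
      (Complex.ofRealCLM.contDiff.comp ((contDiff_fibrePsi hL Φ hΦ).comp contDiff_update_zero))
  exact contDiff_one_parametric_setIntegral_of_isBounded (μ := volume) (isBounded_cell L)
    (measurableSet_cell L) hG

/-- `β = L³ ĉ_{-n}(ψ(·|X̂))` in the cell Fourier normalisation of `PeriodicBoseGasFourier`. [folklore] -/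
theorem fibreBeta_eq_cellFourierCoeff (hL : 0 < L) (n : Fin 3 → ℤ) (Φ : PeriodicTrialState (m + 1) L)
    (X : Config (m + 1)) :
    fibreBeta n Φ X = ((L ^ 3 : ℝ) : ℂ) *
      cellFourierCoeff L (fun y => (fibrePsi Φ (Function.update X 0 y) : ℂ)) (-n) := by
  rw [cellFourierCoeff_eq_integral hL, Complex.real_smul, ← mul_assoc]
  have h3 : ((L ^ 3 : ℝ) : ℂ) * (((L ^ 3)⁻¹ : ℝ) : ℂ) = 1 := by
    rw [← Complex.ofReal_mul, mul_inv_cancel₀ (by positivity), Complex.ofReal_one]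
  rw [h3, one_mul, fibreBeta]
  refine setIntegral_congr_fun (measurableSet_cell L) fun y _ => ?_
  rw [conj_cellWave, neg_neg, phase_eq_cellWave]

/-- `|β|² ≤ L³` (Bessel's inequality for the mode `-n` and `∫ψ² = 1`; equivalently Cauchy–Schwarz on
the cell). [folklore] -/
theorem norm_sq_fibreBeta_le (hL : 0 < L) (n : Fin 3 → ℤ) (Φ : PeriodicTrialState (m + 1) L)
    (hΦ : ∀ X, Φ.ψ X ≠ 0) (X : Config (m + 1)) : ‖fibreBeta n Φ X‖ ^ 2 ≤ L ^ 3 := by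
  set f : Space → ℂ := fun y => (fibrePsi Φ (Function.update X 0 y) : ℂ) with hf
  have hfc : Continuous f := Complex.continuous_ofReal.comp
    ((continuous_fibrePsi hL Φ hΦ).comp (continuous_const.update 0 continuous_id))
  have hP := hasSum_sq_cellFourierCoeff hL hfc
  have hnorm : ∫ y in cell L, ‖f y‖ ^ 2 = 1 := by
    simp only [hf, Complex.norm_real, Real.norm_eq_abs, sq_abs]
    exact integral_fibrePsi_sq hL Φ hΦ X
  rw [hnorm, mul_one] at hP
  have hle : ‖cellFourierCoeff L f (-n)‖ ^ 2 ≤ (L ^ 3)⁻¹ :=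
    le_hasSum hP (-n) fun j _ => sq_nonneg _
  have hL3 : (0 : ℝ) < L ^ 3 := by positivity
  rw [fibreBeta_eq_cellFourierCoeff hL, norm_mul, mul_pow, Complex.norm_real,
    Real.norm_of_nonneg hL3.le]
  calc (L ^ 3) ^ 2 * ‖cellFourierCoeff L f (-n)‖ ^ 2 ≤ (L ^ 3) ^ 2 * (L ^ 3)⁻¹ := by gcongr
    _ = L ^ 3 := by field_simp

/-- `β` is continuous. [folklore] -/
theorem continuous_fibreBeta (hL : 0 < L) (n : Fin 3 → ℤ) (Φ : PeriodicTrialState (m + 1) L)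
    (hΦ : ∀ X, Φ.ψ X ≠ 0) : Continuous (fibreBeta n Φ) :=
  (contDiff_fibreBeta hL n Φ hΦ).continuous

/-! ### Periodic integration by parts in the fibre variable -/

/-- Chain rule for slices at particle `0` (complex-valued): the `e_k`-derivative of
`y ↦ F(insertNth 0 y Y)` is the `(0,k)` partial derivative of `F`. [folklore] -/
theorem fderiv_slice_zero_apply {F : Config (m + 1) → ℂ} (hF : Differentiable ℝ F)
    (k : Fin 3) (Y : Fin m → Space) (x : Space) :
    fderiv ℝ (fun y : Space => F (Fin.insertNth (α := fun _ => Space) 0 y Y)) x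
        (EuclideanSpace.single k 1) =
      fderiv ℝ F (Fin.insertNth (α := fun _ => Space) 0 x Y)
        (Pi.single 0 (EuclideanSpace.single k 1)) := by
  -- adapted from Cruxes/FibreConductance/Disproof.lean (`fderiv_slice_apply_complex`)
  have h := ((hF _).hasFDerivAt.comp x (hasFDerivAt_insertNth 0 Y x)).fderiv
  rw [show (fun y : Space => F (Fin.insertNth (α := fun _ => Space) 0 y Y)) =
      F ∘ fun y : Space => (Fin.insertNth (α := fun _ => Space) 0 y Y : Config (m + 1)) from rfl, h,
    ContinuousLinearMap.comp_apply, pi_single_id_apply]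

/-- **Periodic integration by parts in the fibre variable**: for a `C¹` function on configuration
space, `Lℤ³`-periodic in particle `0`, `∫_{cell^N} ∂_{x_{0,l}} F dX = 0`. [folklore] -/
theorem integral_cellN_fderiv_zero (hL : 0 < L) {F : Config (m + 1) → ℂ} (hF : ContDiff ℝ 1 F)
    (hper : ∀ (X : Config (m + 1)) (k : Fin 3),
      F (X + Pi.single (0 : Fin (m + 1)) (EuclideanSpace.single k L)) = F X)
    (l : Fin 3) :
    ∫ X in cellN (m + 1) L, fderiv ℝ F X (Pi.single 0 (EuclideanSpace.single l 1)) = 0 := by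
  -- adapted from Cruxes/FibreConductance/Disproof.lean (`integral_cellN_fderiv_eq_zero`)
  have hFd : Differentiable ℝ F := hF.differentiable one_ne_zero
  set P : Config (m + 1) → ℂ := fun X => fderiv ℝ F X (Pi.single 0 (EuclideanSpace.single l 1))
    with hP
  have hPc : Continuous P := (hF.continuous_fderiv one_ne_zero).clm_apply continuous_const
  set e := MeasurableEquiv.piFinSuccAbove (fun _ : Fin (m + 1) => Space) 0 with he
  have hmp : MeasurePreserving e.symm (volume.prod volume) volume :=
    (volume_preserving_piFinSuccAbove (fun _ : Fin (m + 1) => Space) 0).symm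
  have hesymm : ∀ z : Space × (Fin m → Space),
      e.symm z = Fin.insertNth (α := fun _ => Space) 0 z.1 z.2 := by
    intro z
    rw [he, MeasurableEquiv.piFinSuccAbove_symm_apply]
    funext j
    exact Fin.insertNthEquiv_apply _ _ _ _
  have hpre : e.symm ⁻¹' cellN (m + 1) L = cell L ×ˢ cellN m L := by
    ext ⟨x, Y⟩
    simp only [Set.mem_preimage, hesymm, Set.mem_prod, cellN, Set.mem_setOf_eq]
    rw [Fin.forall_iff_succAbove 0]
    simp [Fin.insertNth_apply_same]
  have h1 : ∫ X in cellN (m + 1) L, P X =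
      ∫ z in cell L ×ˢ cellN m L, P (Fin.insertNth (α := fun _ => Space) 0 z.1 z.2)
        ∂(volume.prod volume) := by
    rw [← hpre, ← hmp.setIntegral_preimage_emb e.symm.measurableEmbedding]
    simp only [hesymm]
  show ∫ X in cellN (m + 1) L, P X = 0
  rw [h1, ← Measure.prod_restrict]
  have hint : Integrable
      (fun z : Space × (Fin m → Space) => P (Fin.insertNth (α := fun _ => Space) 0 z.1 z.2))
      ((volume.restrict (cell L)).prod (volume.restrict (cellN m L))) := by
    rw [Measure.prod_restrict, ← hpre]
    have hio : IntegrableOn P (cellN (m + 1) L) volume := integrableOn_cellN hPc L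
    have h2 := (hmp.integrableOn_comp_preimage e.symm.measurableEmbedding).2 hio
    simpa only [IntegrableOn, Function.comp_def, hesymm] using h2
  rw [integral_prod_symm _ hint]
  refine integral_eq_zero_of_ae (Filter.Eventually.of_forall fun Y => ?_)
  have hg : ContDiff ℝ 1 (fun y : Space => F (Fin.insertNth (α := fun _ => Space) 0 y Y)) :=
    hF.comp (contDiff_insertNth 0 Y)
  have hgper : ∀ (y : Space) (k : Fin 3),
      F (Fin.insertNth (α := fun _ => Space) 0 (y + EuclideanSpace.single k L) Y) =
        F (Fin.insertNth (α := fun _ => Space) 0 y Y) := by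
    intro y k
    rw [insertNth_add_eq, hper]
  have h0 := integral_cell_fderiv_eq_zero hL hg hgper l
  simp_rw [fderiv_slice_zero_apply hFd l Y] at h0
  exact h0

end Summit.AtomisticToContinuum.BoseEinsteinCondensation.Cruxes.FibreConductance.ParsevalShellBootstrap

end
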